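import Literature.Probability.Percolation.ArmSeparationInSlotsFour
import Literature.Probability.Percolation.ArmSeparationOutSepFour
import HarnessLib

/-!
# Separation of the private supports of a four-arm inner landing slot

Topic `Literature/Probability/Percolation`; family `crit-perc`. A brick of the near-critical
arm-separation theorem for four arms of alternating colours (P. Nolin, *Near-critical percolation
in two dimensions*, EJP 13 (2008), Thm. 11 for `j = 4`, `σ = BWBW` [arXiv 0711.4948: Thm. 10],
§4.4 p. 13 with §4.3 Lemma 13 [arXiv Lemma 12]: the increasing and the decreasing corridor events
must live on disjoint sets of sites). The inner twin of `ArmSeparationOutSepFour.lean`: for a slot of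
the four-arm INNER landing step (`ArmSeparationInSlotsFour.lean`) in a valid rung with
`R₀ ≥ 16 μ` (tips away from the corners by more than the deepest spoke), in range, admissible and
satisfying the routing predicate, the private supports of arms of different colours are disjoint
(`disjoint_privE`), and every private support lies inside `Λ̊_m`, off the shared support
`{m ≤ |v| ≤ R}` (`disjoint_sharedFin_privE`). The pieces (near set, ring arc, approach box, target
box) are located (`mem_privE_cases`, `approach_bounds`, `target_bounds`) and compared pairwise: by
norm bands, by sectors (`sectorNear`), and — where a spoke crosses a ring of lower level or an
approach tube a ring of higher level — by the windows of the routing predicate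
(`ringTube_disjoint_of_lat`). Everything here is proved; no named facts are introduced.

## References

* P. Nolin, Near-critical percolation in two dimensions, *Electron. J. Probab.* 13 (2008), §4.3
  Lemma 13, §4.4 (arXiv 0711.4948: Lemma 12; proof of Thm. 10, p. 13) [Nolin2008].
* H. Kesten, Scaling relations for 2D-percolation, *Comm. Math. Phys.* 109 (1987), Lemma 2 [Kesten1987].
-/

noncomputable section

open Set

namespace Literature.Probability.Percolation

open LatticeModels Tube

/-! ### Slots in range, admissible -/

namespace InSlot4

variable (P : LParams) (σ : InSlot4)

/-- **The slot's indices are in range**: frames `< 6`, scale indices `< K`, target choices `< 5`,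
levels `< 8`. [folklore] -/
structure InRange : Prop where
  /-- frames -/
  hfr : ∀ e, σ.fr e < 6
  /-- scale indices -/
  hsc : ∀ e, σ.sc e < P.K
  /-- target choices -/
  htc : ∀ e, σ.tc e < 5
  /-- levels -/
  hlv : ∀ e, σ.lv e < 8

/-- **Admissible slot**: every window can hold a middle tip row `t` with `-m + R₀ ≤ t ≤ -R₀`. [folklore] -/
def Adm (P' : LParams) (σ' : InSlot4) : Prop := ∀ e, σ'.T P' e ≤ -(P'.R₀ : ℤ) ∧ -(P'.m : ℤ) + P'.R₀ < σ'.T P' e + P'.w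

variable {P σ}

/-- A slot holding the arm `e` has an admissible window for `e`. [folklore] -/
theorem adm_of_mem {e : Fin 4} {ω : SiteConfig (Site 2)} (hω : ω ∈ σ.armE P e) :
    σ.T P e ≤ -(P.R₀ : ℤ) ∧ -(P.m : ℤ) + P.R₀ < σ.T P e + P.w := by
  obtain ⟨z, u, -, -, F, -, h1, h2, -⟩ := hω
  have hmid : -(P.m : ℤ) + P.R₀ ≤ F.z 1 ∧ F.z 1 ≤ -(P.R₀ : ℤ) := F.z_mid
  exact ⟨by omega, by omega⟩

/-- The reflected frame is a frame. [folklore] -/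
theorem fr'_lt (hσ : σ.InRange P) (e : Fin 4) : σ.fr' e < 6 := by
  unfold fr'; split_ifs
  · exact Nat.mod_lt _ (by norm_num)
  · exact hσ.hfr e

/-- **The numeric facts of the arm `e` of a valid rung and a slot in range** (scale, ring, spoke,
approach, target). [folklore] -/
theorem arm_facts (hV : P.Valid) (hK : 1 ≤ P.K) (hσ : σ.InRange P) (e : Fin 4) :
    (P.k₀ : ℤ) ≤ σ.k P e ∧ 32 * (σ.k P e : ℤ) ≤ P.μ ∧
      (σ.r P e : ℤ) ≤ P.m - (2 * σ.lv e + 1) * P.μ ∧ (P.m : ℤ) - (2 * σ.lv e + 1) * P.μ < σ.r P e + P.s ∧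
      ((σ.nr P e : ℕ) : ℤ) * P.s = σ.r P e ∧ (P.n : ℤ) - (P.n / 8 : ℕ) + 1 + σ.W P e = σ.r P e + 2 * P.e ∧
      (P.n : ℤ) + P.s + 2 * P.e ≤ σ.r P e ∧ (σ.r P e : ℤ) + 2 * P.e ≤ P.m ∧
      (σ.L P e : ℤ) = (2 * σ.lv e + 1) * P.μ + 2 * P.s + 4 * P.e ∧
      1 ≤ σ.nr P e ∧ σ.nr P e = σ.r P e / P.s ∧ σ.G P e = 12 * σ.nr P e - 4 ∧ P.s ∣ σ.r P e ∧
      (-(P.n : ℤ) + (P.n / 4 : ℕ) + (P.n / 16 : ℕ) ≤ σ.t P e ∧ σ.t P e ≤ -((P.n / 4 : ℕ) : ℤ) - (P.n / 16 : ℕ)) ∧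
      ((P.μ : ℤ) ≤ (2 * σ.lv e + 1) * P.μ ∧ (2 * (σ.lv e : ℤ) + 1) * P.μ ≤ 15 * P.μ) := by
  have hk1 : (P.k₀ : ℤ) ≤ σ.k P e := by exact_mod_cast le_trapScale P.k₀ (σ.sc e)
  have hk2 : 32 * (σ.k P e : ℤ) ≤ P.μ := by exact_mod_cast P.scale_le (hσ.hsc e)
  obtain ⟨r1, r2, r3, r4, r5, r6, r7⟩ := hV.iring_ifacts (hσ.hlv e)
  obtain ⟨-, -, n3, n4, -, -, -, n8, -⟩ := hV.iring_facts (hσ.hlv e)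
  have hdiv : P.s ∣ σ.r P e := ⟨P.inL (σ.lv e), by rw [mul_comm]; exact n3.symm⟩
  have hμ0 : (0 : ℤ) ≤ P.μ := by positivity
  have hlv : (σ.lv e : ℤ) ≤ 7 := by have := hσ.hlv e; omega
  have hlv0 : (0 : ℤ) ≤ σ.lv e := by positivity
  exact ⟨hk1, hk2, r1, r2, r3, r4, r5, r6, r7, n4, rfl, n8, hdiv, hV.itgtRow4_mem hK (hσ.htc e), by nlinarith, by nlinarith⟩

end InSlot4

/-! ### Where the pieces of a private support are -/

namespace InSlot4

variable {P : LParams} {σ : InSlot4}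

/-- **The pieces of a private support.** A site of `privE e` lies in the near set of the tip of `e`
(slot frame box and spoke, absolute frame `fr e`), or in the box of a ring tube of the ring of `e` at an
absolute position whose reading position is on the arc, or in the approach box, or in the target box
(both `frameIso (ts e)` of the standard boxes). [folklore] -/
theorem mem_privE_cases (hV : P.Valid) (hK : 1 ≤ P.K) (hσ : σ.InRange P) (hR : RouteOK P σ) {e : Fin 4} {v : Site 2}
    (hv : v ∈ (↑(σ.privE P e) : Set (Site 2))) :
    v ∈ nearSet (σ.fr e) P.m (σ.k P e) (σ.T P e) P.w (σ.L P e) P.ε ∨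
      (∃ g, g < σ.G P e ∧ InArc (σ.G P e) (σ.ast e) (σ.aln e) (σ.toView P e g) ∧ v ∈ (ringTube (σ.r P e) P.e P.s g).box) ∨
      v ∈ frameIso (Slot4.ts e) '' triStrip ((P.n : ℤ) - (P.n / 8 : ℕ) + 1) (σ.t P e) (σ.W P e) (P.n / 64) ∨
      v ∈ frameIso (Slot4.ts e) '' triStrip ((P.n : ℤ) - (P.n / 8 : ℕ) + 1) (σ.t P e - (P.n / 64 : ℕ)) (P.n / 8 - 2) (2 * (P.n / 64)) := by
  obtain ⟨-, -, -, -, -, -, -, -, -, hn1, hns, hG, -, -, -⟩ := arm_facts hV hK hσ e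
  obtain ⟨hast, -, haln⟩ := hR.1 e
  have hfr := hσ.hfr e
  unfold privE at hv
  rw [Finset.coe_image, coe_icorrFin4] at hv
  obtain ⟨u, hu, rfl⟩ := hv
  have hview_fr : ∀ x : Site 2, viewMap e (frameIso (σ.fr' e) x) = frameIso (σ.fr e) x := fun x => by
    unfold viewMap InSlot4.fr'
    by_cases h2 : 2 ≤ (e : ℕ)
    · rw [if_pos h2, if_pos h2, frameIso_add_three hfr, neg_neg]
    · rw [if_neg h2, if_neg h2]
  have hview_bs : ∀ x : Site 2, viewMap e (frameIso (Slot4.bs e) x) = frameIso (Slot4.ts e) x := fun x => by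
    unfold viewMap Slot4.ts
    have hbs : Slot4.bs e < 6 := by unfold Slot4.bs; split_ifs <;> norm_num
    by_cases h2 : 2 ≤ (e : ℕ)
    · rw [if_pos h2, if_pos h2, ← frameIso_add_three hbs]
      unfold Slot4.bs; split_ifs <;> rfl
    · rw [if_neg h2, if_neg h2]
  rcases hu with ((⟨x, hx, rfl⟩ | hu) | ⟨x, hx, rfl⟩)
  · left; rw [hview_fr]; exact ⟨x, hx, rfl⟩
  · right; left
    obtain ⟨T, hT, huT⟩ := hu
    have hGdef : σ.G P e = 12 * (σ.r P e / P.s) - 4 := by rw [hG, hns]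
    have hshdef : σ.shift P e = if 2 ≤ (e : ℕ) then 6 * (σ.r P e / P.s) - 2 else 0 := by unfold InSlot4.shift; rw [hns]
    rw [hns] at hn1
    rw [hGdef] at hast haln
    obtain ⟨g, hg, hin, rfl⟩ := exists_pos_of_mem_arc hn1 hast haln hT
    have hg' : g < σ.G P e := by rw [hGdef]; exact hg
    have hGpos : 0 < σ.G P e := by omega
    have hshift : σ.shift P e < σ.G P e := by rw [hshdef, hGdef]; split_ifs <;> omega
    refine ⟨(g + σ.shift P e) % σ.G P e, Nat.mod_lt _ hGpos, ?_, ?_⟩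
    · have hview : σ.toView P e ((g + σ.shift P e) % σ.G P e) = g := by
        unfold InSlot4.toView; exact mod_add_sub_cancel hshift hg'
      rw [hview, hGdef]
      exact hin
    · rw [hGdef, hshdef]
      exact mem_ringTube_box_of_viewMap e hn1 hg huT
  · rcases hx with hx | hx
    · right; right; left; rw [hview_bs]; exact ⟨x, hx, rfl⟩
    · right; right; right; rw [hview_bs]; exact ⟨x, hx, rfl⟩

/-- **Where the approach box is**: in the sector of its side with margin `n/8`, lateral coordinate in
`[t, t + n/64]`, norm in `[n - n/8 + 1, r + 2e]` (valid rung, slot in range). [folklore] -/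
theorem approach_bounds (hV : P.Valid) (hK : 1 ≤ P.K) (hσ : σ.InRange P) {e : Fin 4} {v : Site 2}
    (hv : v ∈ frameIso (Slot4.ts e) '' triStrip ((P.n : ℤ) - (P.n / 8 : ℕ) + 1) (σ.t P e) (σ.W P e) (P.n / 64)) :
    v ∈ sectorNear (Slot4.ts e) ((P.n / 8 : ℕ) : ℤ) ∧ σ.t P e ≤ lat (Slot4.ts e) v ∧ lat (Slot4.ts e) v ≤ σ.t P e + (P.n / 64 : ℕ) ∧
      (P.n : ℤ) - (P.n / 8 : ℕ) + 1 ≤ triNorm v ∧ triNorm v ≤ (σ.r P e : ℤ) + 2 * P.e := by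
  obtain ⟨-, -, -, -, -, r4, r5, -, -, -, -, -, -, ⟨ht1, ht2⟩, -⟩ := arm_facts hV hK hσ e
  obtain ⟨x, hx, rfl⟩ := hv
  rw [mem_triStrip] at hx
  have hts := Slot4.ts_lt e
  refine ⟨(frameIso_mem_sectorNear_iff hts).2 ⟨by omega, by omega⟩, by rw [lat_frameIso hts]; exact hx.2.2.1,
    by rw [lat_frameIso hts]; exact hx.2.2.2, ?_, ?_⟩
  · rw [triNorm_frameIso _ hts]; exact le_triNorm_iff_lin.2 (Or.inl hx.1)
  · rw [triNorm_frameIso _ hts]; exact triNorm_le_iff_lin.2 (by omega)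

/-- **Where the target box is**: in the sector of its side with margin `n/8`, lateral coordinate in
`[t - n/64, t + n/64]`, norm in `[n - n/8 + 1, n - 1]`. [folklore] -/
theorem target_bounds (hV : P.Valid) (hK : 1 ≤ P.K) (hσ : σ.InRange P) {e : Fin 4} {v : Site 2}
    (hv : v ∈ frameIso (Slot4.ts e) '' triStrip ((P.n : ℤ) - (P.n / 8 : ℕ) + 1) (σ.t P e - (P.n / 64 : ℕ)) (P.n / 8 - 2) (2 * (P.n / 64))) :
    v ∈ sectorNear (Slot4.ts e) ((P.n / 8 : ℕ) : ℤ) ∧ σ.t P e - (P.n / 64 : ℕ) ≤ lat (Slot4.ts e) v ∧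
      lat (Slot4.ts e) v ≤ σ.t P e + (P.n / 64 : ℕ) ∧ (P.n : ℤ) - (P.n / 8 : ℕ) + 1 ≤ triNorm v ∧ triNorm v ≤ (P.n : ℤ) - 1 := by
  obtain ⟨-, -, -, -, -, -, -, -, -, -, -, -, -, ⟨ht1, ht2⟩, -⟩ := arm_facts hV hK hσ e
  have hn : 128 ≤ P.n := hV.hn
  obtain ⟨x, hx, rfl⟩ := hv
  rw [mem_triStrip] at hx
  have hts := Slot4.ts_lt e
  have h8 : ((P.n / 8 - 2 : ℕ) : ℤ) = (P.n / 8 : ℕ) - 2 := by omega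
  rw [h8] at hx
  push_cast at hx
  refine ⟨(frameIso_mem_sectorNear_iff hts).2 ⟨by omega, by omega⟩, by rw [lat_frameIso hts]; exact hx.2.2.1,
    by rw [lat_frameIso hts]; omega, ?_, ?_⟩
  · rw [triNorm_frameIso _ hts]; exact le_triNorm_iff_lin.2 (Or.inl hx.1)
  · rw [triNorm_frameIso _ hts]; exact triNorm_le_iff_lin.2 (by omega)

/-! ### The pieces, pairwise -/

/-- **Near sets of arms of different colours are disjoint** (window gap on a common frame from the
routing predicate, sectors otherwise; `R₀ ≥ 16 μ` keeps the deep spokes inside their sectors). [folklore] -/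
theorem near_near_false (hV : P.Valid) (hK : 1 ≤ P.K) (hR16 : 16 * P.μ ≤ P.R₀) (hσ : σ.InRange P) (hadm : σ.Adm P)
    (hR : RouteOK P σ) {e b : Fin 4} (hcol : Slot4.col e ≠ Slot4.col b)
    {v : Site 2} (hve : v ∈ nearSet (σ.fr e) P.m (σ.k P e) (σ.T P e) P.w (σ.L P e) P.ε)
    (hvb : v ∈ nearSet (σ.fr b) P.m (σ.k P b) (σ.T P b) P.w (σ.L P b) P.ε) : False := by
  obtain ⟨hs, hw, he, hε, hk₀, -, -, -, -, -, -, -, hm, -, hn, hμn, hR₀, -⟩ := hV.facts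
  obtain ⟨ke1, ke2, -, -, -, -, -, -, Le, -, -, -, -, -, hμe, hμe'⟩ := arm_facts hV hK hσ e
  obtain ⟨kb1, kb2, -, -, -, -, -, -, Lb, -, -, -, -, -, hμb, hμb'⟩ := arm_facts hV hK hσ b
  have hsep : σ.fr e ≠ σ.fr b ∨ σ.T P e + 8 * σ.k P e < σ.T P b + P.w ∨ σ.T P b + 8 * σ.k P b < σ.T P e + P.w := by
    by_cases h : σ.fr e = σ.fr b
    · exact Or.inr (hR.2.2.2.2.2.2.2 e b hcol h)
    · exact Or.inl h
  have hR16' : 16 * (P.μ : ℤ) ≤ P.R₀ := by exact_mod_cast hR16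
  have hw4 : 4 * (P.w : ℤ) ≤ P.k₀ := by rw [hw]; omega
  have hε' : (P.ε : ℤ) ≤ P.k₀ := by rw [hε]; omega
  have he' : 4 * (P.e : ℤ) ≤ P.k₀ := by rw [he]; omega
  have hsk : (P.s : ℤ) = P.k₀ := by rw [hs]
  exact nearSet_disjoint_nearSet (hσ.hfr e) (hσ.hfr b) (by omega) (by omega) (by omega) (by omega)
    (by zify; rw [Le]; nlinarith) (by zify; rw [Lb]; nlinarith) ⟨(hadm e).1, (hadm e).2, (hadm b).1, (hadm b).2⟩
    (by rw [Le, Lb]; omega) ⟨by omega, by omega⟩ hsep hve hvb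

/-- **The slot box of a near set meets no ring** (its norm is at least `m - 5k`, above every ring). [folklore] -/
theorem slotBox_norm_ge (hV : P.Valid) (hK : 1 ≤ P.K) (hσ : σ.InRange P) {e : Fin 4} {u : Site 2}
    (hu : u ∈ (↑(slotFrame P.m (σ.k P e) (σ.T P e) P.w) : Set (Site 2))) : (P.m : ℤ) - 5 * σ.k P e ≤ triNorm (frameIso (σ.fr e) u) := by
  obtain ⟨ke1, -⟩ := arm_facts hV hK hσ e
  have hk₀ := hV.hk₀
  rw [Finset.mem_coe, mem_slotFrame (by omega)] at hu
  rw [triNorm_frameIso (σ.fr e) (hσ.hfr e)]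
  exact le_triNorm_iff_lin.2 (Or.inl hu.1)

/-- **A near set and a ring of another colour**: the slot box is above every ring; the spoke is above
the ring of `b` if `b` is on a deeper level, and passes it through the spoke window, off the arc of
`b`, otherwise (routing predicate). [folklore] -/
theorem near_arc_false (hV : P.Valid) (hK : 1 ≤ P.K) (hR16 : 16 * P.μ ≤ P.R₀) (hσ : σ.InRange P) (hadm : σ.Adm P)
    (hR : RouteOK P σ) {e b : Fin 4} (hcol : Slot4.col e ≠ Slot4.col b)
    (heb : e ≠ b) {v : Site 2} (hve : v ∈ nearSet (σ.fr e) P.m (σ.k P e) (σ.T P e) P.w (σ.L P e) P.ε)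
    {g : ℕ} (hg : g < σ.G P b) (hin : InArc (σ.G P b) (σ.ast b) (σ.aln b) (σ.toView P b g))
    (hvb : v ∈ (ringTube (σ.r P b) P.e P.s g).box) : False := by
  obtain ⟨hs, hw, he, hε, hk₀, -, -, -, -, -, -, -, hm, -, hn, hμn, hR₀, -⟩ := hV.facts
  obtain ⟨ke1, ke2, re1, re2, -, -, -, -, Le, -, -, -, -, -, hμe, hμe'⟩ := arm_facts hV hK hσ e
  obtain ⟨kb1, kb2, rb1, rb2, nsb, -, rb5, -, -, nb1, nsb', Gb, dvb, -, hμb, hμb'⟩ := arm_facts hV hK hσ b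
  obtain ⟨ha1, ha2⟩ := hadm e
  have hR16' : 16 * (P.μ : ℤ) ≤ P.R₀ := by exact_mod_cast hR16
  have hw4 : 4 * (P.w : ℤ) ≤ P.k₀ := by rw [hw]; omega
  have hε' : 16 * (P.ε : ℤ) ≤ P.k₀ := by rw [hε]; omega
  have he' : 4 * (P.e : ℤ) ≤ P.k₀ := by rw [he]; omega
  have hsk : (P.s : ℤ) = P.k₀ := by rw [hs]
  rw [nsb'] at nb1
  have hgb : g < 12 * (σ.r P b / P.s) - 4 := by rw [Gb, nsb'] at hg; exact hg
  have heb' : 2 * P.e ≤ σ.r P b := by zify; omega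
  obtain ⟨-, -, -, -, hnorm2⟩ := ringTube_bounds nb1 dvb heb' hgb hvb
  obtain ⟨u, hu, rfl⟩ := hve
  rcases hu with hu | hu
  · -- the slot box is above every ring
    have h := slotBox_norm_ge hV hK hσ hu
    omega
  -- the spoke
  have hub := hu
  rw [Tube.mem_box] at hub
  simp only [spokeTube, bcnCentre, site_mk_apply_zero, site_mk_apply_one] at hub
  push_cast at hub
  obtain ⟨h1, h2, h3, h4⟩ := hub
  have hξlo : -(σ.r P b : ℤ) + P.s ≤ σ.ξ P e := by unfold InSlot4.ξ; omega
  have hξhi : σ.ξ P e + 2 * P.s < 0 := by unfold InSlot4.ξ; omega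
  have hlv : σ.lv e ≠ σ.lv b := hR.2.1 e b heb
  rcases lt_or_gt_of_ne hlv with hlt | hlt
  · -- `b` on a deeper level: the spoke of `e` ends above the ring of `b`
    have hle : (σ.lv e : ℤ) + 1 ≤ σ.lv b := by exact_mod_cast hlt
    have hμ0 : (0 : ℤ) ≤ P.μ := by positivity
    have hkey : (2 * (σ.lv e : ℤ) + 1) * P.μ + 2 * P.μ ≤ (2 * (σ.lv b : ℤ) + 1) * P.μ := by
      rw [show (2 * (σ.lv e : ℤ) + 1) * P.μ + 2 * P.μ = (2 * (σ.lv e : ℤ) + 3) * P.μ by ring]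
      exact mul_le_mul_of_nonneg_right (by linarith) hμ0
    have key : (σ.r P b : ℤ) + 2 * P.e < P.m - 2 * σ.k P e + 1 - σ.L P e := by rw [Le]; omega
    have hn2 : (P.m : ℤ) - 2 * σ.k P e + 1 - σ.L P e ≤ triNorm u := le_triNorm_iff_lin.2 (Or.inl (by omega))
    rw [← triNorm_frameIso (σ.fr e) (hσ.hfr e)] at hn2
    linarith
  · -- `b` on a higher level: the spoke crosses the ring of `b` through its window, off the arc
    have hwin := hR.2.2.2.2.1 b e hcol.symm hlt
    set ι := latIdx P.s (σ.r P b) (σ.ξ P e) with hι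
    have hξr : -(σ.r P b : ℤ) ≤ σ.ξ P e := by unfold InSlot4.ξ; omega
    have hι1 : 1 ≤ ι := le_latIdx_of_le (m := 1) (by omega) (by push_cast; linarith)
    have hι2 : ι + 2 < σ.nr P b := latIdx_add_lt (m := 2) (by omega) nsb hξr (by push_cast; linarith)
    rw [nsb'] at hι2
    have hde : P.ε + P.e < P.s := by omega
    have hι2' : ι + 2 ≤ σ.r P b / P.s := by omega
    have hlam : 2 * (P.e : ℤ) < (P.R₀ : ℤ) - σ.L P e - P.ε - 2 * P.e := by rw [Le]; omega
    have hout : g < min (piecePos (σ.r P b / P.s) (σ.fr e) (ι - 1)) (piecePos (σ.r P b / P.s) (σ.fr e) (ι + 1)) ∨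
        max (piecePos (σ.r P b / P.s) (σ.fr e) (ι - 1)) (piecePos (σ.r P b / P.s) (σ.fr e) (ι + 1)) + 1 < g := by
      by_contra hc
      push Not at hc
      have hlo : σ.spokeWinLo P e b = min (piecePos (σ.r P b / P.s) (σ.fr e) (ι - 1)) (piecePos (σ.r P b / P.s) (σ.fr e) (ι + 1)) ∧
          max (piecePos (σ.r P b / P.s) (σ.fr e) (ι - 1)) (piecePos (σ.r P b / P.s) (σ.fr e) (ι + 1)) + 1 = σ.spokeWinLo P e b + 5 := by
        unfold InSlot4.spokeWinLo piecePos
        rw [← nsb', ← hι]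
        rw [← nsb'] at hι2
        constructor <;> split_ifs <;> simp only [min_def, max_def] <;> split_ifs <;> omega
      obtain ⟨q, hq, hgq⟩ : ∃ q, q < 6 ∧ g = σ.spokeWinLo P e b + q := ⟨g - σ.spokeWinLo P e b, by omega, by omega⟩
      rw [hgq] at hin
      exact hwin q hq hin
    refine Set.disjoint_left.1 (ringTube_disjoint_of_lat rfl nb1 dvb heb' (d := P.ε) hde hgb (hσ.hfr e) hξr le_rfl hι1 hι2' hout
      (S := frameIso (σ.fr e) '' (spokeTube P.m (σ.k P e) (σ.T P e) P.w (σ.L P e) P.ε).box) (lam := (P.R₀ : ℤ) - σ.L P e - P.ε - 2 * P.e)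
      hlam ?_ ?_) hvb ⟨u, hu, rfl⟩
    · rintro x hx
      obtain ⟨y, rfl, g1, g2, g3, g4⟩ := exists_of_mem_image_spokeBox hx
      refine (frameIso_mem_sectorNear_iff (hσ.hfr e)).2 ⟨?_, ?_⟩
      · unfold InSlot4.ξ at hξhi; omega
      · unfold InSlot4.ξ at hξlo; rw [Le]; omega
    · rintro x hx
      obtain ⟨y, rfl, g1, g2, g3, g4⟩ := exists_of_mem_image_spokeBox hx
      rw [lat_frameIso (hσ.hfr e)]
      unfold InSlot4.ξ; constructor <;> omega

/-- **A near set and the approach box of another colour**: sectors on different sides, the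
danger-zone condition of the routing predicate on a common side. [folklore] -/
theorem near_appr_false (hV : P.Valid) (hK : 1 ≤ P.K) (hR16 : 16 * P.μ ≤ P.R₀) (hσ : σ.InRange P) (hadm : σ.Adm P)
    (hR : RouteOK P σ) {e b : Fin 4} (hcol : Slot4.col e ≠ Slot4.col b)
    {v : Site 2} (hve : v ∈ nearSet (σ.fr e) P.m (σ.k P e) (σ.T P e) P.w (σ.L P e) P.ε)
    (hvb : v ∈ frameIso (Slot4.ts b) '' triStrip ((P.n : ℤ) - (P.n / 8 : ℕ) + 1) (σ.t P b) (σ.W P b) (P.n / 64)) : False := by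
  obtain ⟨hs, hw, he, hε, hk₀, -, -, -, -, -, -, -, hm, -, hn, hμn, hR₀, -⟩ := hV.facts
  obtain ⟨ke1, ke2, -, -, -, -, -, -, Le, -, -, -, -, -, hμe, hμe'⟩ := arm_facts hV hK hσ e
  obtain ⟨ha1, ha2⟩ := hadm e
  have hR16' : 16 * (P.μ : ℤ) ≤ P.R₀ := by exact_mod_cast hR16
  have hw4 : 4 * (P.w : ℤ) ≤ P.k₀ := by rw [hw]; omega
  have hε' : (P.ε : ℤ) ≤ P.k₀ := by rw [hε]; omega
  have he' : 4 * (P.e : ℤ) ≤ P.k₀ := by rw [he]; omega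
  have hsk : (P.s : ℤ) = P.k₀ := by rw [hs]
  obtain ⟨hsec, hl1, hl2, -⟩ := approach_bounds hV hK hσ hvb
  obtain ⟨u, rfl, hu0, hu0', hu1, hu1'⟩ := exists_of_mem_nearSet (by omega) (by omega) (by zify; rw [Le]; nlinarith) hve
  by_cases hside : σ.fr e = Slot4.ts b
  · -- rows
    have hfar := hR.2.2.2.2.2.2.1 e b hcol hside
    rw [← hside, lat_frameIso (hσ.hfr e)] at hl1 hl2
    unfold InSlot4.ξ at hfar
    rcases hfar with hfar | hfar <;> omega
  · have hse : frameIso (σ.fr e) u ∈ sectorNear (σ.fr e) ((P.R₀ : ℤ) - (σ.L P e + 4 * σ.k P e + P.w)) :=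
      (frameIso_mem_sectorNear_iff (hσ.hfr e)).2 ⟨by omega, by omega⟩
    refine Set.disjoint_left.1 (disjoint_sectorNear (hσ.hfr e) (Slot4.ts_lt b) hside ?_) hse hsec
    rw [Le]; omega

/-- **A near set lies above every target box** (norm `≥ m - 2k + 1 - L > n`). [folklore] -/
theorem near_tgt_false (hV : P.Valid) (hK : 1 ≤ P.K) (hσ : σ.InRange P) {e b : Fin 4}
    {v : Site 2} (hve : v ∈ nearSet (σ.fr e) P.m (σ.k P e) (σ.T P e) P.w (σ.L P e) P.ε)
    (hvb : v ∈ frameIso (Slot4.ts b) '' triStrip ((P.n : ℤ) - (P.n / 8 : ℕ) + 1) (σ.t P b - (P.n / 64 : ℕ)) (P.n / 8 - 2) (2 * (P.n / 64))) :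
    False := by
  obtain ⟨hs, hw, he, hε, hk₀, -, -, -, -, -, -, -, hm, -, hn, hμn, hR₀, -⟩ := hV.facts
  obtain ⟨ke1, ke2, -, -, -, -, -, -, Le, -, -, -, -, -, hμe, hμe'⟩ := arm_facts hV hK hσ e
  have hε' : (P.ε : ℤ) ≤ P.k₀ := by rw [hε]; omega
  have he' : 4 * (P.e : ℤ) ≤ P.k₀ := by rw [he]; omega
  have hsk : (P.s : ℤ) = P.k₀ := by rw [hs]
  obtain ⟨-, -, -, -, hnorm⟩ := target_bounds hV hK hσ hvb
  obtain ⟨u, rfl, hu0, -, -, -⟩ := exists_of_mem_nearSet (by omega) (by omega) (by zify; rw [Le]; nlinarith) hve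
  have h := le_triNorm_iff_lin.2 (Or.inl hu0)
  rw [← triNorm_frameIso (σ.fr e) (hσ.hfr e)] at h
  rw [Le] at h
  omega

/-- **Rings of distinct levels lie in disjoint norm bands.** [folklore] -/
theorem arc_arc_false (hV : P.Valid) (hK : 1 ≤ P.K) (hσ : σ.InRange P) (hR : RouteOK P σ) {e b : Fin 4} (heb : e ≠ b)
    {g : ℕ} (hg : g < σ.G P e) {v : Site 2} (hve : v ∈ (ringTube (σ.r P e) P.e P.s g).box)
    {g' : ℕ} (hg' : g' < σ.G P b) (hvb : v ∈ (ringTube (σ.r P b) P.e P.s g').box) : False := by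
  obtain ⟨hs, hw, he, hε, hk₀, -, -, -, -, -, -, -, hm, -, hn, hμn, hR₀, -⟩ := hV.facts
  obtain ⟨ke1, ke2, re1, re2, -, -, re5, -, -, ne1, nse, Ge, dve, -, hμe, -⟩ := arm_facts hV hK hσ e
  obtain ⟨-, -, rb1, rb2, -, -, rb5, -, -, nb1, nsb, Gb, dvb, -, hμb, -⟩ := arm_facts hV hK hσ b
  have he' : 4 * (P.e : ℤ) ≤ P.k₀ := by rw [he]; omega
  have hsk : (P.s : ℤ) = P.k₀ := by rw [hs]
  rw [nse] at ne1; rw [nsb] at nb1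
  have hge : g < 12 * (σ.r P e / P.s) - 4 := by rw [Ge, nse] at hg; exact hg
  have hgb : g' < 12 * (σ.r P b / P.s) - 4 := by rw [Gb, nsb] at hg'; exact hg'
  obtain ⟨-, -, -, e1, e2⟩ := ringTube_bounds ne1 dve (by zify; omega) hge hve
  obtain ⟨-, -, -, b1, b2⟩ := ringTube_bounds nb1 dvb (by zify; omega) hgb hvb
  have hlv : σ.lv e ≠ σ.lv b := hR.2.1 e b heb
  have hμ0 : (0 : ℤ) ≤ P.μ := by positivity
  rcases lt_or_gt_of_ne hlv with hlt | hlt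
  · have hle : (σ.lv e : ℤ) + 1 ≤ σ.lv b := by exact_mod_cast hlt
    have hkey : (2 * (σ.lv e : ℤ) + 1) * P.μ + 2 * P.μ ≤ (2 * (σ.lv b : ℤ) + 1) * P.μ := by
      rw [show (2 * (σ.lv e : ℤ) + 1) * P.μ + 2 * P.μ = (2 * (σ.lv e : ℤ) + 3) * P.μ by ring]
      exact mul_le_mul_of_nonneg_right (by linarith) hμ0
    omega
  · have hle : (σ.lv b : ℤ) + 1 ≤ σ.lv e := by exact_mod_cast hlt
    have hkey : (2 * (σ.lv b : ℤ) + 1) * P.μ + 2 * P.μ ≤ (2 * (σ.lv e : ℤ) + 1) * P.μ := by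
      rw [show (2 * (σ.lv b : ℤ) + 1) * P.μ + 2 * P.μ = (2 * (σ.lv b : ℤ) + 3) * P.μ by ring]
      exact mul_le_mul_of_nonneg_right (by linarith) hμ0
    omega

/-- **A ring and the approach box of another colour**: above the box if the box leaves a deeper ring;
otherwise the box crosses the ring through the approach window, off the arc (routing predicate). [folklore] -/
theorem arc_appr_false (hV : P.Valid) (hK : 1 ≤ P.K) (hσ : σ.InRange P) (hR : RouteOK P σ) {e b : Fin 4}
    (hcol : Slot4.col e ≠ Slot4.col b) (heb : e ≠ b)
    {g : ℕ} (hg : g < σ.G P e) (hin : InArc (σ.G P e) (σ.ast e) (σ.aln e) (σ.toView P e g))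
    {v : Site 2} (hve : v ∈ (ringTube (σ.r P e) P.e P.s g).box)
    (hvb : v ∈ frameIso (Slot4.ts b) '' triStrip ((P.n : ℤ) - (P.n / 8 : ℕ) + 1) (σ.t P b) (σ.W P b) (P.n / 64)) : False := by
  obtain ⟨hs, hw, he, hε, hk₀, hkμ, -, -, -, -, -, -, hm, -, hn, hμn, hR₀, -⟩ := hV.facts
  have he' : 4 * (P.e : ℤ) ≤ P.k₀ := by rw [he]; omega
  have hsk : (P.s : ℤ) = P.k₀ := by rw [hs]
  have hlam2 : 2 * (P.e : ℤ) < ((P.n / 8 : ℕ) : ℤ) := by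
    have h1 : (P.k₀ : ℤ) ≤ P.μ := by exact_mod_cast hkμ
    have h2 : 64 * (P.μ : ℤ) ≤ P.n := by exact_mod_cast hμn
    omega
  obtain ⟨ke1, ke2, re1, re2, nse', -, re5, -, -, ne1, nse, Ge, dve, -, hμe, -⟩ := arm_facts hV hK hσ e
  obtain ⟨-, -, rb1, rb2, -, -, rb5, -, -, -, -, -, -, ⟨tb1, tb2⟩, hμb, -⟩ := arm_facts hV hK hσ b
  rw [nse] at ne1
  have hge : g < 12 * (σ.r P e / P.s) - 4 := by rw [Ge, nse] at hg; exact hg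
  have hee : 2 * P.e ≤ σ.r P e := by zify; omega
  obtain ⟨-, -, -, e1, e2⟩ := ringTube_bounds ne1 dve hee hge hve
  obtain ⟨-, hl1, hl2, -, hnorm⟩ := approach_bounds hV hK hσ hvb
  have hlv : σ.lv e ≠ σ.lv b := hR.2.1 e b heb
  have hμ0 : (0 : ℤ) ≤ P.μ := by positivity
  rcases lt_or_gt_of_ne hlv with hlt | hlt
  · have hle : (σ.lv e : ℤ) + 1 ≤ σ.lv b := by exact_mod_cast hlt
    have hkey : (2 * (σ.lv e : ℤ) + 1) * P.μ + 2 * P.μ ≤ (2 * (σ.lv b : ℤ) + 1) * P.μ := by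
      rw [show (2 * (σ.lv e : ℤ) + 1) * P.μ + 2 * P.μ = (2 * (σ.lv e : ℤ) + 3) * P.μ by ring]
      exact mul_le_mul_of_nonneg_right (by linarith) hμ0
    omega
  · -- the approach tube of `b` crosses the ring of `e` off the arc
    have hwin := hR.2.2.2.2.2.1 e b hcol hlt
    have htr : -(σ.r P e : ℤ) ≤ σ.t P b := by omega
    have hιA : 1 ≤ latIdx P.s (σ.r P e) (σ.t P b) := le_latIdx_of_le (m := 1) (by omega) (by push_cast; omega)
    have hιB : latIdx P.s (σ.r P e) (σ.t P b + (P.n / 64 : ℕ)) + 2 < σ.nr P e :=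
      latIdx_add_lt (m := 2) (by omega) nse' (by omega) (by push_cast; omega)
    rw [nse] at hιB
    have hde : 0 + P.e < P.s := by omega
    have hAB : σ.t P b ≤ σ.t P b + (P.n / 64 : ℕ) := by omega
    have hιB' : latIdx P.s (σ.r P e) (σ.t P b + (P.n / 64 : ℕ)) + 2 ≤ σ.r P e / P.s := by omega
    have hGlt : ∀ g', g' < 12 * (σ.r P e / P.s) - 4 → g' < 12 * σ.nr P e := fun g' hg' =>
      Nat.lt_of_lt_of_le hg' (by rw [nse]; exact Nat.sub_le _ _)
    have hSsec : frameIso (Slot4.ts b) '' triStrip ((P.n : ℤ) - (P.n / 8 : ℕ) + 1) (σ.t P b) (σ.W P b) (P.n / 64) ⊆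
        sectorNear (Slot4.ts b) ((P.n / 8 : ℕ) : ℤ) := fun x hx => (approach_bounds hV hK hσ (e := b) hx).1
    have hSlat : ∀ x ∈ frameIso (Slot4.ts b) '' triStrip ((P.n : ℤ) - (P.n / 8 : ℕ) + 1) (σ.t P b) (σ.W P b) (P.n / 64),
        σ.t P b - (0 : ℕ) ≤ lat (Slot4.ts b) x ∧ lat (Slot4.ts b) x ≤ σ.t P b + (P.n / 64 : ℕ) + (0 : ℕ) := fun x hx => by
      obtain ⟨-, q1, q2, -⟩ := approach_bounds hV hK hσ (e := b) hx
      simp only [Nat.cast_zero, sub_zero, add_zero]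
      exact ⟨q1, q2⟩
    have hout : g < min (piecePos (σ.r P e / P.s) (Slot4.ts b) (latIdx P.s (σ.r P e) (σ.t P b) - 1))
          (piecePos (σ.r P e / P.s) (Slot4.ts b) (latIdx P.s (σ.r P e) (σ.t P b + (P.n / 64 : ℕ)) + 1)) ∨
        max (piecePos (σ.r P e / P.s) (Slot4.ts b) (latIdx P.s (σ.r P e) (σ.t P b) - 1))
          (piecePos (σ.r P e / P.s) (Slot4.ts b) (latIdx P.s (σ.r P e) (σ.t P b + (P.n / 64 : ℕ)) + 1)) + 1 < g := by
      by_contra hc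
      push Not at hc
      have hlo : σ.apprWinLo P b e ≤ g ∧ g ≤ σ.apprWinHi P b e := by
        unfold InSlot4.apprWinLo InSlot4.apprWinHi; rw [nse]; exact ⟨hc.1, hc.2⟩
      exact hwin g (hGlt g hge) hlo.1 hlo.2 hin
    exact Set.disjoint_left.1 (ringTube_disjoint_of_lat rfl ne1 dve hee (d := 0) hde hge (Slot4.ts_lt b) htr hAB hιA
      hιB' hout (lam := ((P.n / 8 : ℕ) : ℤ)) hlam2 hSsec hSlat) hve hvb

/-- **Rings lie above every target box** (norm `≥ r - s - 2e > n`). [folklore] -/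
theorem arc_tgt_false (hV : P.Valid) (hK : 1 ≤ P.K) (hσ : σ.InRange P) {e b : Fin 4}
    {g : ℕ} (hg : g < σ.G P e) {v : Site 2} (hve : v ∈ (ringTube (σ.r P e) P.e P.s g).box)
    (hvb : v ∈ frameIso (Slot4.ts b) '' triStrip ((P.n : ℤ) - (P.n / 8 : ℕ) + 1) (σ.t P b - (P.n / 64 : ℕ)) (P.n / 8 - 2) (2 * (P.n / 64))) :
    False := by
  obtain ⟨hs, hw, he, hε, hk₀, -, -, -, -, -, -, -, hm, -, hn, hμn, hR₀, -⟩ := hV.facts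
  obtain ⟨ke1, ke2, re1, re2, -, -, re5, -, -, ne1, nse, Ge, dve, -, hμe, -⟩ := arm_facts hV hK hσ e
  have he' : 4 * (P.e : ℤ) ≤ P.k₀ := by rw [he]; omega
  have hsk : (P.s : ℤ) = P.k₀ := by rw [hs]
  rw [nse] at ne1
  have hge : g < 12 * (σ.r P e / P.s) - 4 := by rw [Ge, nse] at hg; exact hg
  obtain ⟨-, -, -, e1, e2⟩ := ringTube_bounds ne1 dve (by zify; omega) hge hve
  obtain ⟨-, -, -, -, hnorm⟩ := target_bounds hV hK hσ hvb
  omega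

/-- **Approach and target boxes of distinct arms lie in distinct sectors.** [folklore] -/
theorem far_far_false (hV : P.Valid) (hK : 1 ≤ P.K) (hσ : σ.InRange P) {e b : Fin 4} (heb : e ≠ b) {v : Site 2}
    (hve : v ∈ frameIso (Slot4.ts e) '' triStrip ((P.n : ℤ) - (P.n / 8 : ℕ) + 1) (σ.t P e) (σ.W P e) (P.n / 64) ∨
      v ∈ frameIso (Slot4.ts e) '' triStrip ((P.n : ℤ) - (P.n / 8 : ℕ) + 1) (σ.t P e - (P.n / 64 : ℕ)) (P.n / 8 - 2) (2 * (P.n / 64)))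
    (hvb : v ∈ frameIso (Slot4.ts b) '' triStrip ((P.n : ℤ) - (P.n / 8 : ℕ) + 1) (σ.t P b) (σ.W P b) (P.n / 64) ∨
      v ∈ frameIso (Slot4.ts b) '' triStrip ((P.n : ℤ) - (P.n / 8 : ℕ) + 1) (σ.t P b - (P.n / 64 : ℕ)) (P.n / 8 - 2) (2 * (P.n / 64))) :
    False := by
  have hn : 128 ≤ P.n := hV.hn
  have hM : (0 : ℤ) < ((P.n / 8 : ℕ) : ℤ) := by exact_mod_cast (show 0 < P.n / 8 by omega)
  have hse : v ∈ sectorNear (Slot4.ts e) ((P.n / 8 : ℕ) : ℤ) := by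
    rcases hve with h | h
    · exact (approach_bounds hV hK hσ h).1
    · exact (target_bounds hV hK hσ h).1
  have hsb : v ∈ sectorNear (Slot4.ts b) ((P.n / 8 : ℕ) : ℤ) := by
    rcases hvb with h | h
    · exact (approach_bounds hV hK hσ h).1
    · exact (target_bounds hV hK hσ h).1
  exact Set.disjoint_left.1 (disjoint_sectorNear (Slot4.ts_lt e) (Slot4.ts_lt b) (Slot4.ts_ne_of_ne heb) (by omega)) hse hsb

/-! ### The supports are pairwise disjoint -/

/-- **The private support of an open arm is disjoint from that of a closed arm** (valid rung with
`R₀ ≥ 16 μ`, `K ≥ 1`, slot in range and admissible, routing predicate). [cite: Nolin2008, §4.3 Lemma 13 (arXiv 0711.4948: Lemma 12, `𝒜⁺ ∩ 𝒜⁻ = ∅`)] -/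
theorem disjoint_privE (hV : P.Valid) (hK : 1 ≤ P.K) (hR16 : 16 * P.μ ≤ P.R₀) (hσ : σ.InRange P) (hadm : σ.Adm P)
    (hR : RouteOK P σ) {e b : Fin 4} (hcol : Slot4.col e ≠ Slot4.col b) :
    Disjoint (σ.privE P e) (σ.privE P b) := by
  have heb : e ≠ b := fun h => hcol (by rw [h])
  rw [Finset.disjoint_left]
  intro v hve hvb
  have hve' := mem_privE_cases hV hK hσ hR (Finset.mem_coe.2 hve)
  have hvb' := mem_privE_cases hV hK hσ hR (Finset.mem_coe.2 hvb)
  rcases hve' with hve' | ⟨g, hg, hin, hve'⟩ | hve' | hve'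
  · rcases hvb' with hvb' | ⟨g', hg', hin', hvb'⟩ | hvb' | hvb'
    · exact near_near_false hV hK hR16 hσ hadm hR hcol hve' hvb'
    · exact near_arc_false hV hK hR16 hσ hadm hR hcol heb hve' hg' hin' hvb'
    · exact near_appr_false hV hK hR16 hσ hadm hR hcol hve' hvb'
    · exact near_tgt_false hV hK hσ hve' hvb'
  · rcases hvb' with hvb' | ⟨g', hg', hin', hvb'⟩ | hvb' | hvb'
    · exact near_arc_false hV hK hR16 hσ hadm hR hcol.symm heb.symm hvb' hg hin hve'
    · exact arc_arc_false hV hK hσ hR heb hg hve' hg' hvb'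
    · exact arc_appr_false hV hK hσ hR hcol heb hg hin hve' hvb'
    · exact arc_tgt_false hV hK hσ hg hve' hvb'
  · rcases hvb' with hvb' | ⟨g', hg', hin', hvb'⟩ | hvb' | hvb'
    · exact near_appr_false hV hK hR16 hσ hadm hR hcol.symm hvb' hve'
    · exact arc_appr_false hV hK hσ hR hcol.symm heb.symm hg' hin' hvb' hve'
    · exact far_far_false hV hK hσ heb (Or.inl hve') (Or.inl hvb')
    · exact far_far_false hV hK hσ heb (Or.inl hve') (Or.inr hvb')
  · rcases hvb' with hvb' | ⟨g', hg', hin', hvb'⟩ | hvb' | hvb'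
    · exact near_tgt_false hV hK hσ hvb' hve'
    · exact arc_tgt_false hV hK hσ hg' hvb' hve'
    · exact far_far_false hV hK hσ heb (Or.inr hve') (Or.inl hvb')
    · exact far_far_false hV hK hσ heb (Or.inr hve') (Or.inr hvb')

/-- **Every private support lies inside `Λ̊_m`, off the shared support `{m ≤ |v| ≤ R}`.** [cite: Nolin2008, §4.3 Lemma 13 (arXiv 0711.4948: Lemma 12, `𝒜 ∩ 𝒜^± = ∅`)] -/
theorem disjoint_sharedFin_privE (hV : P.Valid) (hK : 1 ≤ P.K) (hσ : σ.InRange P) (hadm : σ.Adm P) (hR : RouteOK P σ) (R : ℕ)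
    (e : Fin 4) : Disjoint (sharedFin P.m R) (σ.privE P e) := by
  obtain ⟨hs, hw, he, hε, hk₀, -, -, -, -, -, -, -, hm, -, hn, hμn, hR₀, -⟩ := hV.facts
  obtain ⟨ke1, ke2, re1, re2, -, -, re5, re6, Le, ne1, nse, Ge, dve, -, hμe, -⟩ := arm_facts hV hK hσ e
  obtain ⟨ha1, ha2⟩ := hadm e
  have hw4 : 4 * (P.w : ℤ) ≤ P.k₀ := by rw [hw]; omega
  have hε' : (P.ε : ℤ) ≤ P.k₀ := by rw [hε]; omega
  have he' : 4 * (P.e : ℤ) ≤ P.k₀ := by rw [he]; omega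
  have hsk : (P.s : ℤ) = P.k₀ := by rw [hs]
  rw [Finset.disjoint_left]
  intro v hvs hve
  rw [mem_sharedFin] at hvs
  rcases mem_privE_cases hV hK hσ hR (Finset.mem_coe.2 hve) with h | ⟨g, hg, -, h⟩ | h | h
  · obtain ⟨u, rfl, hu0, hu0', hu1, hu1'⟩ := exists_of_mem_nearSet (by omega) (by omega) (by zify; rw [Le]; nlinarith) h
    have hle : triNorm u ≤ (P.m : ℤ) - 1 := triNorm_le_iff_lin.2 (by omega)
    rw [← triNorm_frameIso (σ.fr e) (hσ.hfr e)] at hle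
    omega
  · rw [nse] at ne1
    have hge : g < 12 * (σ.r P e / P.s) - 4 := by rw [Ge, nse] at hg; exact hg
    obtain ⟨-, -, -, -, e2⟩ := ringTube_bounds ne1 dve (by zify; omega) hge h
    omega
  · have := (approach_bounds hV hK hσ h).2.2.2.2
    omega
  · have := (target_bounds hV hK hσ h).2.2.2.2
    omega

end InSlot4

end Literature.Probability.Percolation
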